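import Literature.AlgebraicGeometry.ModuliOfAbelianVarieties.SiegelFamilyProductLociHodgeGroup
import Literature.AlgebraicGeometry.ModuliOfAbelianVarieties.SiegelFamilyProductLociCMPoints
import Literature.NumberTheory.ComplexMultiplication.SiegelCMPointsDegreeOneHodgeGroup
import HarnessLib

/-!
# The Hodge group on the product locus `𝔥₁ × 𝔥_n → 𝔥_{1+n}` with a NON-CM elliptic block and a CM-type block:
# `Hg(X_{(τ 0; 0 Z)}) = SL₂ × Hg(X_Z)` in the symplectic coordinates (Moonen–Zarhin §3 Theorem (Hazama) (2); Imai)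

Layer `Literature/AlgebraicGeometry/ModuliOfAbelianVarieties`, namespace
`Literature.AlgebraicGeometry.ModuliOfAbelianVarieties.SiegelModuli`; lane `lit-hodgefound` (Track 2 foundations
library, Layer A1 «Mumford–Tate / Hodge groups of the members of the Siegel family»), prover seat p17, generation 30,
self-proposed row g30-#9 — an EQUALITY case for g30-#3 (`SiegelFamilyProductLociHodgeGroup`: on the product locus
`Hg(X_{(Z₁ 0; 0 Z₂)}) ⊆ Hg(X_{Z₁}) × Hg(X_{Z₂})`, with equality exactly when `Hg(X_{Z₁} × X_{Z₂}) = Hg(X_{Z₁}) × Hg(X_{Z₂})`,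
`mem_hodgeGroup_prinPeriod_blockDiagPoint_iff_of_hodgeGroup_prod_eq`): for `τ ∈ 𝔥₁` NOT a CM point and `Z ∈ 𝔥_n` a point of
CM type (`Hg(X_Z)(ℂ)` commutative — equivalently `MT(X_Z)` a torus, skel-A3's `setOf_isTorusSubgroup_mumfordTateGroupC_eq_setOf_hodgeGroupC_comm`)
the Kaehler layer's `hodgeGroup_prod_eq_of_endAlgRat_eq_bot` (p34: Moonen–Zarhin §3 Theorem (2) / Imai for
`E × X₂`, `End_ℚ(E) = ℚ`, `Hg(X₂)(ℂ)` commutative) gives the product, once the elliptic curve `E_τ` of the Kaehler layer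
(lattice index `Fin 2`) is relabelled to the Siegel torus `X_τ` (index `Fin 1 ⊕ Fin 1`, g28-#5's
`jMatrix_prinPeriod_one_eq_jMatrix_reindex`).  THEOREMS ONLY: no definition, no instance, no named fact, nothing
conditional (D-0026, net debt 0).

## Sources, verbatim

* B. Moonen, Yu. Zarhin, *Hodge classes on abelian varieties of low dimension*, Math. Ann. 315 (1999) 711–733,
  arXiv:math/9901113 (held text `paper:arxiv-math_9901113`), §3 Theorem (Hazama) (chunk p0006 L70–L76): «Let `X₁` and
  `X₂` be complex abelian varieties … (2) Suppose `X₁` has no factors of Type IV and `X₂` is of CM-type. Then …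
  `Hg(X₁ × X₂) = Hg(X₁) × Hg(X₂)`.»
* H. Imai, *On the Hodge groups of some abelian varieties*, Kōdai Math. Sem. Rep. 27 (1976) 367–372 (held
  `paper:doi-10-2996-kmj-1138847263`), §1 p. 367: «`Hg(A₁ × A₂) ⊂ Hg(A₁) × Hg(A₂)` and the projection to each factor is
  surjective»; §2 Proposition p. 368 and its proof p. 370 (the case «`E_{m+1}, …, E_n` not of CM-type»: `Hg(E) = SL₂`).
* J. Carlson, S. Müller-Stach, C. Peters, *Period Mappings and Period Domains* (2nd ed. 2017), §15.2 Examples 15.2.4 (ii):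
  «if `C` has no complex multiplication … `MT(H¹(C)) = GL(2)`».
* M. Green, P. Griffiths, M. Kerr, *Mumford–Tate Groups and Domains* (2012), §III.B (i) (p. 72): `M_{φ₁ ⊕ φ₂} ⊆ M_{φ₁} × M_{φ₂}`.

## What is proved (`τ = Z₁ ∈ 𝔥₁`, `Z = Z₂ ∈ 𝔥_n`, `e : Fin 1 ⊕ Fin n ≃ Fin g`; `ε` with g30-#3's compatibilities `h₁–h₄`)

* §1 (private) the relabelling `θ = (Fin 2 ≃ Fin 1 ⊕ Fin 1) ⊕ id` of a block sum.
* §2 **`hodgeGroup_prod_prinPeriod_one_eq_of_not_isCMPoint`** (`Hg(X_τ × X_Z)(ℝ) = Hg(X_τ)(ℝ) × Hg(X_Z)(ℝ)` block-diagonally,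
  for `τ` non-CM and `Hg(X_Z)(ℂ)` commutative), `…_of_not_isCMPoint_of_isTorusSubgroup` (the same with «`MT(X_Z)` is a torus»);
* §3 **`mem_hodgeGroup_prinPeriod_blockDiagPoint_iff_of_not_isCMPoint`** (`M ∈ Hg(X_{(τ 0; 0 Z)})(ℝ) ⟺
  M = reindex_ε (A 0; 0 B)` with `A ∈ SL(ℝ^{λ¹,μ¹})` ARBITRARY and `B ∈ Hg(X_Z)(ℝ)`: `Hg = SL₂ × Hg(X_Z)`),
  `…_of_not_isCMPoint_of_isTorusSubgroup`, `reindexSL_blockDiag_mem_hodgeGroup_prinPeriod_blockDiagPoint_of_not_isCMPoint` (every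
  such block sum IS in the Hodge group — the projection to the first factor is all of `SL₂ = Sp₂`).
* §4 (rider) `hodgeGroup_prod_prinPeriod_one_eq_of_not_isCMPoint'` / `mem_hodgeGroup_prinPeriod_blockDiagPoint_iff_of_not_isCMPoint'`
  (THE MIRRORED ORDER `(Z 0; 0 τ)`: CM-type block first), **`mem_hodgeGroupC_prinPeriod_blockDiagPoint_iff_of_not_isCMPoint`** (THE SAME ON
  COMPLEX POINTS: `Hg(X_{(τ 0; 0 Z)})(ℂ) = SL₂(ℂ) × Hg(X_Z)(ℂ)`).

## Proof route / deviation

`Hg(X_τ × X_Z) ⊆ Hg(X_τ) × Hg(X_Z)` always (`hodgeGroup_prod_le`); for `⊇` the Kaehler layer's equality for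
`E_τ × X_Z` (`E_τ = ellipticPeriod`, `End_ℚ(E_τ) = ℚ` iff `τ` is not imaginary quadratic iff `τ` is not a CM point,
`isCMPoint_one_iff_ellipticEnd_ne_bot`) is moved along the relabelling `θ` of the first block
(`J_{X_τ × X_Z} = reindex_θ J_{E_τ × X_Z}`, `hodgeGroup_eq_map_reindexSL_of_jMatrix_eq`), and `Hg(E_τ) = SL₂` makes the
first component arbitrary.  The case of TWO elliptic blocks (`n = 1`) is g29/g30-#2's diagonal of `𝔥₂` and is not
restated; the mirrored order (CM-type block first) is §4, with the Kaehler layer's primed theorem; the complex points are moved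
by two polynomial relabellings (`isPolyGroupIso_reindexPolyMap` for `θ` and for `ε`).

## References

* [MoonenZarhin1999LowDim] B. Moonen, Yu. Zarhin, *Hodge classes on abelian varieties of low dimension*, Math. Ann. 315
  (1999), 711–733, §3 Theorem (2). [cite: MoonenZarhin1999LowDim, §3 Theorem (2) (p0006 L70–L76)]
* [Imai1976HodgeGroups] H. Imai, *On the Hodge groups of some abelian varieties*, Kōdai Math. Sem. Rep. 27 (1976),
  367–372, §1, §2 Proposition. [cite: Imai1976HodgeGroups, §2 Proposition (pp. 368, 370)]
* [CarlsonMullerStachPeters2017] J. Carlson, S. Müller-Stach, C. Peters, *Period Mappings and Period Domains*, §15.2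
  Examples 15.2.4 (ii). [cite: CarlsonMullerStachPeters2017, §15.2 Examples 15.2.4 (ii)]
* [GreenGriffithsKerr2012] M. Green, P. Griffiths, M. Kerr, *Mumford–Tate Groups and Domains* (2012), §III.B (i).
  [cite: GreenGriffithsKerr2012, §III.B (i) (p. 72)]
-/

noncomputable section

open scoped Matrix Classical
open Matrix Function Set Module

namespace Literature.AlgebraicGeometry.ModuliOfAbelianVarieties

namespace SiegelModuli

open Literature.NumberTheory.Automorphic
open Literature.NumberTheory.ModularForms Literature.NumberTheory.ModularForms.SiegelUpperHalfSpace
open Literature.NumberTheory.ComplexMultiplication Literature.NumberTheory.ComplexMultiplication.SiegelCMPoint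
open Literature.Geometry.Kaehler Literature.Geometry.Kaehler.ComplexTorus

variable {g n : ℕ}

/-! ## §1 Relabelling one block of a block sum -/

section Dictionary

/-- `reindex_{η ⊕ id} (A 0; 0 D) = (reindex_η A 0; 0 D)`. [folklore] -/
private theorem reindex_sumCongr_refl_fromBlocks_zero {α α' β R : Type*} [Zero R] (η : α ≃ α') (A : Matrix α α R)
    (D : Matrix β β R) :
    Matrix.reindex (η.sumCongr (Equiv.refl β)) (η.sumCongr (Equiv.refl β)) (fromBlocks A 0 0 D) =
      fromBlocks (Matrix.reindex η η A) 0 0 D := by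
  ext i j
  rcases i with i | i <;> rcases j with j | j <;> rfl

/-- `reindex_{id ⊕ κ} (A 0; 0 D) = (A 0; 0 reindex_κ D)`. [folklore] -/
private theorem reindex_refl_sumCongr_fromBlocks_zero {α β β' R : Type*} [Zero R] (κ : β ≃ β') (A : Matrix α α R)
    (D : Matrix β β R) :
    Matrix.reindex ((Equiv.refl α).sumCongr κ) ((Equiv.refl α).sumCongr κ) (fromBlocks A 0 0 D) =
      fromBlocks A 0 0 (Matrix.reindex κ κ D) := by
  ext i j
  rcases i with i | i <;> rcases j with j | j <;> rfl

end Dictionary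

/-! ## §2 `Hg(X_τ × X_Z) = Hg(X_τ) × Hg(X_Z)` for `τ ∈ 𝔥₁` non-CM and `Z` of CM type -/

section Product

variable (Z₁ : siegelUpperHalfSpace 1) (Z₂ : siegelUpperHalfSpace n)

/-- **MOONEN–ZARHIN §3 THEOREM (2) / IMAI FOR `X_τ × X_Z`, `τ ∈ 𝔥₁` NOT A CM POINT, `Hg(X_Z)(ℂ)` COMMUTATIVE:
`Hg(X_τ × X_Z)(ℝ) = Hg(X_τ)(ℝ) × Hg(X_Z)(ℝ)`** (block-diagonally; `Hg(X_τ) = SL₂`).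
[cite: MoonenZarhin1999LowDim, §3 Theorem (2) (p0006 L70–L76)] [cite: Imai1976HodgeGroups, §2 Proposition (pp. 368, 370)] -/
theorem hodgeGroup_prod_prinPeriod_one_eq_of_not_isCMPoint (h₁ : ¬ IsCMPoint Z₁)
    (hc : ∀ M ∈ hodgeGroupC (prinPeriod Z₂), ∀ N ∈ hodgeGroupC (prinPeriod Z₂), M * N = N * M) :
    hodgeGroup (prodPeriod (prinPeriod Z₁) (prinPeriod Z₂)) =
      ((hodgeGroup (prinPeriod Z₁)).prod (hodgeGroup (prinPeriod Z₂))).map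
        (ComplexTorus.blockDiag (Fin 1 ⊕ Fin 1) (Fin n ⊕ Fin n)) := by
  refine le_antisymm (hodgeGroup_prod_le _ _) ?_
  rintro _ ⟨⟨M₁, M₂⟩, hM, rfl⟩
  have hE : ellipticEnd (im_apply_pos Z₁).ne' = ⊥ := by
    by_contra h
    exact h₁ (isCMPoint_one_iff_ellipticEnd_ne_bot.2 h)
  have hc' : ∀ M N : SpecialLinearGroup (Fin n ⊕ Fin n) ℂ, M ∈ hodgeGroupC (prinPeriod Z₂) →
      N ∈ hodgeGroupC (prinPeriod Z₂) → M.1 * N.1 = N.1 * M.1 :=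
    fun M N hM hN ↦ congrArg Subtype.val (hc M hM N hN)
  have hfull := hodgeGroup_prod_eq_of_endAlgRat_eq_bot (ellipticPeriod (im_apply_pos Z₁).ne') (prinPeriod Z₂)
    ((endAlgRat_ellipticPeriod_eq_bot_iff _).2 hE) hc'
  have hJ : jMatrix (prodPeriod (prinPeriod Z₁) (prinPeriod Z₂)) =
      Matrix.reindex ((finSumFinEquiv (m := 1) (n := 1)).symm.sumCongr (Equiv.refl (Fin n ⊕ Fin n)))
        ((finSumFinEquiv (m := 1) (n := 1)).symm.sumCongr (Equiv.refl (Fin n ⊕ Fin n)))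
        (jMatrix (prodPeriod (ellipticPeriod (im_apply_pos Z₁).ne') (prinPeriod Z₂))) := by
    rw [jMatrix_prodPeriod, jMatrix_prodPeriod, jMatrix_prinPeriod_one_eq_jMatrix_reindex Z₁, jMatrix_reindex,
      reindex_sumCongr_refl_fromBlocks_zero]
  rw [hodgeGroup_eq_map_reindexSL_of_jMatrix_eq _ hJ, hfull]
  refine Subgroup.mem_map.2 ⟨ComplexTorus.blockDiag (Fin 2) (Fin n ⊕ Fin n)
      (reindexSL (Fin 1 ⊕ Fin 1) (finSumFinEquiv (m := 1) (n := 1)) M₁, M₂),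
    Subgroup.mem_map.2 ⟨(reindexSL (Fin 1 ⊕ Fin 1) (finSumFinEquiv (m := 1) (n := 1)) M₁, M₂),
      Subgroup.mem_prod.2 ⟨?_, (Subgroup.mem_prod.1 hM).2⟩, rfl⟩, Subtype.ext ?_⟩
  · rw [hodgeGroup_ellipticPeriod_eq_top_of_eq_bot _ hE]
    exact Subgroup.mem_top _
  · rw [coe_reindexSL, ComplexTorus.coe_blockDiag, ComplexTorus.coe_blockDiag, coe_reindexSL,
      reindex_sumCongr_refl_fromBlocks_zero, ← Matrix.reindex_symm, Equiv.symm_apply_apply]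

/-- The same with the CM-type hypothesis phrased «`MT(X_Z)(ℂ)` is a torus» (skel-A3: on the Siegel family the torus locus
is the locus where `Hg(X_Z)(ℂ)` is commutative). [cite: MoonenZarhin1999LowDim, §3 Theorem (2) (p0006 L70–L76)]
[cite: Gordon1997, §2 Prop. 2.12] -/
theorem hodgeGroup_prod_prinPeriod_one_eq_of_not_isCMPoint_of_isTorusSubgroup (h₁ : ¬ IsCMPoint Z₁)
    (hT : IsTorusSubgroup (mumfordTateGroupC (prinPeriod Z₂))) :
    hodgeGroup (prodPeriod (prinPeriod Z₁) (prinPeriod Z₂)) =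
      ((hodgeGroup (prinPeriod Z₁)).prod (hodgeGroup (prinPeriod Z₂))).map
        (ComplexTorus.blockDiag (Fin 1 ⊕ Fin 1) (Fin n ⊕ Fin n)) :=
  hodgeGroup_prod_prinPeriod_one_eq_of_not_isCMPoint Z₁ Z₂ h₁
    ((Set.ext_iff.1 (setOf_isTorusSubgroup_mumfordTateGroupC_eq_setOf_hodgeGroupC_comm n) Z₂).1 hT)

end Product

/-! ## §3 On `𝔥_g`: `Hg(X_{(τ 0; 0 Z)}) = Sp₂ × Hg(X_Z)` in the coordinates `(λ, μ)` -/

section Siegel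

variable (e : Fin 1 ⊕ Fin n ≃ Fin g) (Z₁ : siegelUpperHalfSpace 1) (Z₂ : siegelUpperHalfSpace n)
  {ε : (Fin 1 ⊕ Fin 1) ⊕ (Fin n ⊕ Fin n) ≃ Fin g ⊕ Fin g}

/-- **`Hg(X_{(τ 0; 0 Z)})(ℝ) = Sp₂(ℝ) × Hg(X_Z)(ℝ)` FOR `τ ∈ 𝔥₁` NOT A CM POINT AND `Z ∈ 𝔥_n` WITH `Hg(X_Z)(ℂ)` COMMUTATIVE**:
`M ∈ Hg(X_{(τ 0; 0 Z)})(ℝ)` iff `M = reindex_ε (A 0; 0 B)` with `A ∈ SL(ℝ^{λ¹, μ¹})` ARBITRARY and `B ∈ Hg(X_Z)(ℝ)`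
(«the projection to each factor is surjective» — onto `Hg(X_τ) = SL₂` and onto `Hg(X_Z)` — and here the product is
attained). [cite: MoonenZarhin1999LowDim, §3 Theorem (2) (p0006 L70–L76)] [cite: Imai1976HodgeGroups, §1 (p. 367) and §2 Proposition (pp. 368, 370)]
[cite: GreenGriffithsKerr2012, §III.B (i) (p. 72)] -/
theorem mem_hodgeGroup_prinPeriod_blockDiagPoint_iff_of_not_isCMPoint
    (h₁ : ∀ i, ε (Sum.inl (Sum.inl i)) = Sum.inl (e (Sum.inl i))) (h₂ : ∀ i, ε (Sum.inl (Sum.inr i)) = Sum.inr (e (Sum.inl i)))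
    (h₃ : ∀ j, ε (Sum.inr (Sum.inl j)) = Sum.inl (e (Sum.inr j))) (h₄ : ∀ j, ε (Sum.inr (Sum.inr j)) = Sum.inr (e (Sum.inr j)))
    (hτ : ¬ IsCMPoint Z₁) (hc : ∀ M ∈ hodgeGroupC (prinPeriod Z₂), ∀ N ∈ hodgeGroupC (prinPeriod Z₂), M * N = N * M)
    {M : SpecialLinearGroup (Fin g ⊕ Fin g) ℝ} :
    M ∈ hodgeGroup (prinPeriod (blockDiagPoint e Z₁ Z₂)) ↔
      ∃ A : SpecialLinearGroup (Fin 1 ⊕ Fin 1) ℝ, ∃ B ∈ hodgeGroup (prinPeriod Z₂),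
        (M : Matrix (Fin g ⊕ Fin g) (Fin g ⊕ Fin g) ℝ) = Matrix.reindex ε ε (fromBlocks A.1 0 0 B.1) := by
  rw [mem_hodgeGroup_prinPeriod_blockDiagPoint_iff_of_hodgeGroup_prod_eq e Z₁ Z₂ h₁ h₂ h₃ h₄
    (hodgeGroup_prod_prinPeriod_one_eq_of_not_isCMPoint Z₁ Z₂ hτ hc), hodgeGroup_prinPeriod_one_eq_top_iff.2 hτ]
  simp only [Subgroup.mem_top, true_and]

/-- The same with «`MT(X_Z)(ℂ)` is a torus». [cite: MoonenZarhin1999LowDim, §3 Theorem (2) (p0006 L70–L76)] [cite: Gordon1997, §2 Prop. 2.12] -/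
theorem mem_hodgeGroup_prinPeriod_blockDiagPoint_iff_of_not_isCMPoint_of_isTorusSubgroup
    (h₁ : ∀ i, ε (Sum.inl (Sum.inl i)) = Sum.inl (e (Sum.inl i))) (h₂ : ∀ i, ε (Sum.inl (Sum.inr i)) = Sum.inr (e (Sum.inl i)))
    (h₃ : ∀ j, ε (Sum.inr (Sum.inl j)) = Sum.inl (e (Sum.inr j))) (h₄ : ∀ j, ε (Sum.inr (Sum.inr j)) = Sum.inr (e (Sum.inr j)))
    (hτ : ¬ IsCMPoint Z₁) (hT : IsTorusSubgroup (mumfordTateGroupC (prinPeriod Z₂)))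
    {M : SpecialLinearGroup (Fin g ⊕ Fin g) ℝ} :
    M ∈ hodgeGroup (prinPeriod (blockDiagPoint e Z₁ Z₂)) ↔
      ∃ A : SpecialLinearGroup (Fin 1 ⊕ Fin 1) ℝ, ∃ B ∈ hodgeGroup (prinPeriod Z₂),
        (M : Matrix (Fin g ⊕ Fin g) (Fin g ⊕ Fin g) ℝ) = Matrix.reindex ε ε (fromBlocks A.1 0 0 B.1) :=
  mem_hodgeGroup_prinPeriod_blockDiagPoint_iff_of_not_isCMPoint e Z₁ Z₂ h₁ h₂ h₃ h₄ hτ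
    ((Set.ext_iff.1 (setOf_isTorusSubgroup_mumfordTateGroupC_eq_setOf_hodgeGroupC_comm n) Z₂).1 hT)

/-- **EVERY BLOCK SUM `reindex_ε (A 0; 0 B)`, `A ∈ Sp₂(ℝ) = SL₂(ℝ)`, `B ∈ Hg(X_Z)(ℝ)`, LIES IN `Hg(X_{(τ 0; 0 Z)})(ℝ)`** (`τ` non-CM,
`Hg(X_Z)(ℂ)` commutative) — the inclusion `⊆ Hg(X_τ) × Hg(X_Z)` of g30-#3 is an equality here.
[cite: MoonenZarhin1999LowDim, §3 Theorem (2) (p0006 L70–L76)] [cite: Imai1976HodgeGroups, §2 Proposition (pp. 368, 370)] -/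
theorem reindexSL_blockDiag_mem_hodgeGroup_prinPeriod_blockDiagPoint_of_not_isCMPoint
    (h₁ : ∀ i, ε (Sum.inl (Sum.inl i)) = Sum.inl (e (Sum.inl i))) (h₂ : ∀ i, ε (Sum.inl (Sum.inr i)) = Sum.inr (e (Sum.inl i)))
    (h₃ : ∀ j, ε (Sum.inr (Sum.inl j)) = Sum.inl (e (Sum.inr j))) (h₄ : ∀ j, ε (Sum.inr (Sum.inr j)) = Sum.inr (e (Sum.inr j)))
    (hτ : ¬ IsCMPoint Z₁) (hc : ∀ M ∈ hodgeGroupC (prinPeriod Z₂), ∀ N ∈ hodgeGroupC (prinPeriod Z₂), M * N = N * M)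
    (A : SpecialLinearGroup (Fin 1 ⊕ Fin 1) ℝ) {B : SpecialLinearGroup (Fin n ⊕ Fin n) ℝ} (hB : B ∈ hodgeGroup (prinPeriod Z₂)) :
    reindexSL ((Fin 1 ⊕ Fin 1) ⊕ (Fin n ⊕ Fin n)) ε (ComplexTorus.blockDiag (Fin 1 ⊕ Fin 1) (Fin n ⊕ Fin n) (A, B)) ∈
      hodgeGroup (prinPeriod (blockDiagPoint e Z₁ Z₂)) :=
  (mem_hodgeGroup_prinPeriod_blockDiagPoint_iff_of_not_isCMPoint e Z₁ Z₂ h₁ h₂ h₃ h₄ hτ hc).2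
    ⟨A, B, hB, by rw [coe_reindexSL, ComplexTorus.coe_blockDiag]⟩

end Siegel

/-! ## §4 The mirrored order `(Z 0; 0 τ)` and complex points (rider, same seat) -/

section Mirror

variable (Z₂ : siegelUpperHalfSpace n) (Z₁ : siegelUpperHalfSpace 1)

/-- **THE MIRRORED ORDER: `Hg(X_Z × X_τ)(ℝ) = Hg(X_Z)(ℝ) × Hg(X_τ)(ℝ)`** for `Hg(X_Z)(ℂ)` commutative and `τ ∈ 𝔥₁` not a CM
point (the Kaehler layer's primed theorem, CM-type factor first). [cite: MoonenZarhin1999LowDim, §3 Theorem (2) (p0006 L70–L76)]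
[cite: Imai1976HodgeGroups, §2 Proposition (pp. 368, 370)] -/
theorem hodgeGroup_prod_prinPeriod_one_eq_of_not_isCMPoint'
    (hc : ∀ M ∈ hodgeGroupC (prinPeriod Z₂), ∀ N ∈ hodgeGroupC (prinPeriod Z₂), M * N = N * M) (h₁ : ¬ IsCMPoint Z₁) :
    hodgeGroup (prodPeriod (prinPeriod Z₂) (prinPeriod Z₁)) =
      ((hodgeGroup (prinPeriod Z₂)).prod (hodgeGroup (prinPeriod Z₁))).map
        (ComplexTorus.blockDiag (Fin n ⊕ Fin n) (Fin 1 ⊕ Fin 1)) := by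
  refine le_antisymm (hodgeGroup_prod_le _ _) ?_
  rintro _ ⟨⟨M₂, M₁⟩, hM, rfl⟩
  have hE : ellipticEnd (im_apply_pos Z₁).ne' = ⊥ := by
    by_contra h
    exact h₁ (isCMPoint_one_iff_ellipticEnd_ne_bot.2 h)
  have hc' : ∀ M N : SpecialLinearGroup (Fin n ⊕ Fin n) ℂ, M ∈ hodgeGroupC (prinPeriod Z₂) →
      N ∈ hodgeGroupC (prinPeriod Z₂) → M.1 * N.1 = N.1 * M.1 :=
    fun M N hM hN ↦ congrArg Subtype.val (hc M hM N hN)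
  have hfull := hodgeGroup_prod_eq_of_endAlgRat_eq_bot' (prinPeriod Z₂) (ellipticPeriod (im_apply_pos Z₁).ne') hc'
    ((endAlgRat_ellipticPeriod_eq_bot_iff _).2 hE)
  have hJ : jMatrix (prodPeriod (prinPeriod Z₂) (prinPeriod Z₁)) =
      Matrix.reindex ((Equiv.refl (Fin n ⊕ Fin n)).sumCongr (finSumFinEquiv (m := 1) (n := 1)).symm)
        ((Equiv.refl (Fin n ⊕ Fin n)).sumCongr (finSumFinEquiv (m := 1) (n := 1)).symm)
        (jMatrix (prodPeriod (prinPeriod Z₂) (ellipticPeriod (im_apply_pos Z₁).ne'))) := by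
    rw [jMatrix_prodPeriod, jMatrix_prodPeriod, jMatrix_prinPeriod_one_eq_jMatrix_reindex Z₁, jMatrix_reindex,
      reindex_refl_sumCongr_fromBlocks_zero]
  rw [hodgeGroup_eq_map_reindexSL_of_jMatrix_eq _ hJ, hfull]
  refine Subgroup.mem_map.2 ⟨ComplexTorus.blockDiag (Fin n ⊕ Fin n) (Fin 2)
      (M₂, reindexSL (Fin 1 ⊕ Fin 1) (finSumFinEquiv (m := 1) (n := 1)) M₁),
    Subgroup.mem_map.2 ⟨(M₂, reindexSL (Fin 1 ⊕ Fin 1) (finSumFinEquiv (m := 1) (n := 1)) M₁),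
      Subgroup.mem_prod.2 ⟨(Subgroup.mem_prod.1 hM).1, ?_⟩, rfl⟩, Subtype.ext ?_⟩
  · rw [hodgeGroup_ellipticPeriod_eq_top_of_eq_bot _ hE]
    exact Subgroup.mem_top _
  · rw [coe_reindexSL, ComplexTorus.coe_blockDiag, ComplexTorus.coe_blockDiag, coe_reindexSL,
      reindex_refl_sumCongr_fromBlocks_zero, ← Matrix.reindex_symm, Equiv.symm_apply_apply]

variable (e : Fin n ⊕ Fin 1 ≃ Fin g) {ε : (Fin n ⊕ Fin n) ⊕ (Fin 1 ⊕ Fin 1) ≃ Fin g ⊕ Fin g}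

/-- **`Hg(X_{(Z 0; 0 τ)})(ℝ) = Hg(X_Z)(ℝ) × Sp₂(ℝ)` IN THE COORDINATES `(λ, μ)`** (`Hg(X_Z)(ℂ)` commutative, `τ` non-CM): `M` lies in
the Hodge group iff `M = reindex_ε (B 0; 0 A)` with `B ∈ Hg(X_Z)(ℝ)` and `A ∈ SL(ℝ^{λ², μ²})` arbitrary.
[cite: MoonenZarhin1999LowDim, §3 Theorem (2) (p0006 L70–L76)] [cite: Imai1976HodgeGroups, §1 (p. 367) and §2 Proposition (pp. 368, 370)] -/
theorem mem_hodgeGroup_prinPeriod_blockDiagPoint_iff_of_not_isCMPoint'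
    (h₁ : ∀ i, ε (Sum.inl (Sum.inl i)) = Sum.inl (e (Sum.inl i))) (h₂ : ∀ i, ε (Sum.inl (Sum.inr i)) = Sum.inr (e (Sum.inl i)))
    (h₃ : ∀ j, ε (Sum.inr (Sum.inl j)) = Sum.inl (e (Sum.inr j))) (h₄ : ∀ j, ε (Sum.inr (Sum.inr j)) = Sum.inr (e (Sum.inr j)))
    (hc : ∀ M ∈ hodgeGroupC (prinPeriod Z₂), ∀ N ∈ hodgeGroupC (prinPeriod Z₂), M * N = N * M) (hτ : ¬ IsCMPoint Z₁)
    {M : SpecialLinearGroup (Fin g ⊕ Fin g) ℝ} :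
    M ∈ hodgeGroup (prinPeriod (blockDiagPoint e Z₂ Z₁)) ↔
      ∃ B ∈ hodgeGroup (prinPeriod Z₂), ∃ A : SpecialLinearGroup (Fin 1 ⊕ Fin 1) ℝ,
        (M : Matrix (Fin g ⊕ Fin g) (Fin g ⊕ Fin g) ℝ) = Matrix.reindex ε ε (fromBlocks B.1 0 0 A.1) := by
  rw [mem_hodgeGroup_prinPeriod_blockDiagPoint_iff_of_hodgeGroup_prod_eq e Z₂ Z₁ h₁ h₂ h₃ h₄
    (hodgeGroup_prod_prinPeriod_one_eq_of_not_isCMPoint' Z₂ Z₁ hc hτ), hodgeGroup_prinPeriod_one_eq_top_iff.2 hτ]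
  simp only [Subgroup.mem_top, true_and]

end Mirror

section ComplexPoints

variable (e : Fin 1 ⊕ Fin n ≃ Fin g) (Z₁ : siegelUpperHalfSpace 1) (Z₂ : siegelUpperHalfSpace n)
  {ε : (Fin 1 ⊕ Fin 1) ⊕ (Fin n ⊕ Fin n) ≃ Fin g ⊕ Fin g}

/-- **ON COMPLEX POINTS: `Hg(X_{(τ 0; 0 Z)})(ℂ) = SL₂(ℂ) × Hg(X_Z)(ℂ)` IN THE COORDINATES `(λ, μ)`** (`τ` non-CM, `Hg(X_Z)(ℂ)`
commutative): `N ∈ Hg(X_{(τ 0; 0 Z)})(ℂ)` iff `N = reindex_ε (A 0; 0 B)` with `A ∈ SL₂(ℂ)` arbitrary and `B ∈ Hg(X_Z)(ℂ)` (Imai works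
on complex points: «`h^σ ∈ H` for all `σ ∈ Aut(C)`»). [cite: MoonenZarhin1999LowDim, §3 Theorem (2) (p0006 L70–L76)]
[cite: Imai1976HodgeGroups, §2 Proposition (pp. 368, 370)] [cite: GreenGriffithsKerr2012, §I.B (I.B.4) (p. 39)] -/
theorem mem_hodgeGroupC_prinPeriod_blockDiagPoint_iff_of_not_isCMPoint
    (h₁ : ∀ i, ε (Sum.inl (Sum.inl i)) = Sum.inl (e (Sum.inl i))) (h₂ : ∀ i, ε (Sum.inl (Sum.inr i)) = Sum.inr (e (Sum.inl i)))
    (h₃ : ∀ j, ε (Sum.inr (Sum.inl j)) = Sum.inl (e (Sum.inr j))) (h₄ : ∀ j, ε (Sum.inr (Sum.inr j)) = Sum.inr (e (Sum.inr j)))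
    (hτ : ¬ IsCMPoint Z₁) (hc : ∀ M ∈ hodgeGroupC (prinPeriod Z₂), ∀ N ∈ hodgeGroupC (prinPeriod Z₂), M * N = N * M)
    {N : SpecialLinearGroup (Fin g ⊕ Fin g) ℂ} :
    N ∈ hodgeGroupC (prinPeriod (blockDiagPoint e Z₁ Z₂)) ↔
      ∃ A : SpecialLinearGroup (Fin 1 ⊕ Fin 1) ℂ, ∃ B ∈ hodgeGroupC (prinPeriod Z₂),
        (N : Matrix (Fin g ⊕ Fin g) (Fin g ⊕ Fin g) ℂ) = Matrix.reindex ε ε (fromBlocks A.1 0 0 B.1) := by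
  have hE : ellipticEnd (im_apply_pos Z₁).ne' = ⊥ := by
    by_contra h
    exact hτ (isCMPoint_one_iff_ellipticEnd_ne_bot.2 h)
  have hc' : ∀ M N : SpecialLinearGroup (Fin n ⊕ Fin n) ℂ, M ∈ hodgeGroupC (prinPeriod Z₂) →
      N ∈ hodgeGroupC (prinPeriod Z₂) → M.1 * N.1 = N.1 * M.1 :=
    fun M N hM hN ↦ congrArg Subtype.val (hc M hM N hN)
  have hfullC := hodgeGroupC_prod_eq_of_endAlgRat_eq_bot (ellipticPeriod (im_apply_pos Z₁).ne') (prinPeriod Z₂)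
    ((endAlgRat_ellipticPeriod_eq_bot_iff _).2 hE) hc'
  have hJθ : jMatrix (prodPeriod (prinPeriod Z₁) (prinPeriod Z₂)) =
      Matrix.reindex ((finSumFinEquiv (m := 1) (n := 1)).symm.sumCongr (Equiv.refl (Fin n ⊕ Fin n)))
        ((finSumFinEquiv (m := 1) (n := 1)).symm.sumCongr (Equiv.refl (Fin n ⊕ Fin n)))
        (jMatrix (prodPeriod (ellipticPeriod (im_apply_pos Z₁).ne') (prinPeriod Z₂))) := by
    rw [jMatrix_prodPeriod, jMatrix_prodPeriod, jMatrix_prinPeriod_one_eq_jMatrix_reindex Z₁, jMatrix_reindex,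
      reindex_sumCongr_refl_fromBlocks_zero]
  have hJε := jMatrix_prinPeriod_blockDiagPoint_eq_reindex e Z₁ Z₂ h₁ h₂ h₃ h₄
  have stepθ : ∀ {M : SpecialLinearGroup ((Fin 1 ⊕ Fin 1) ⊕ (Fin n ⊕ Fin n)) ℂ},
      M ∈ hodgeGroupC (prodPeriod (prinPeriod Z₁) (prinPeriod Z₂)) ↔
        ∃ P ∈ hodgeGroupC (prodPeriod (ellipticPeriod (im_apply_pos Z₁).ne') (prinPeriod Z₂)),
          (reindexPolyMap (Fin 2 ⊕ (Fin n ⊕ Fin n))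
              ((finSumFinEquiv (m := 1) (n := 1)).symm.sumCongr (Equiv.refl (Fin n ⊕ Fin n)))).peval P.1 = M.1 :=
    fun {M} ↦ (isPolyGroupIso_reindexPolyMap _).mem_hodgeGroupC_iff
      (Φ := prodPeriod (ellipticPeriod (im_apply_pos Z₁).ne') (prinPeriod Z₂))
      (Φ' := prodPeriod (prinPeriod Z₁) (prinPeriod Z₂)) (fun _ _ h ↦ h.elim)
      (fun t ↦ by rw [peval_reindexPolyMap, hodgeCircle_eq_reindex_of_jMatrix_eq _ hJθ])
  rw [(isPolyGroupIso_reindexPolyMap ε).mem_hodgeGroupC_iff (Φ := prodPeriod (prinPeriod Z₁) (prinPeriod Z₂))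
    (Φ' := prinPeriod (blockDiagPoint e Z₁ Z₂)) (fun _ _ h ↦ h.elim)
    (fun t ↦ by rw [peval_reindexPolyMap, hodgeCircle_eq_reindex_of_jMatrix_eq ε hJε])]
  constructor
  · rintro ⟨M, hM, hMN⟩
    obtain ⟨P, hP, hPM⟩ := stepθ.1 hM
    rw [hfullC] at hP
    obtain ⟨⟨A, B⟩, hAB, rfl⟩ := Subgroup.mem_map.1 hP
    refine ⟨⟨Matrix.reindex (finSumFinEquiv (m := 1) (n := 1)).symm (finSumFinEquiv (m := 1) (n := 1)).symm A.1, by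
        rw [Matrix.det_reindex_self, A.2]⟩, B, (Subgroup.mem_prod.1 hAB).2, ?_⟩
    rw [← hMN, peval_reindexPolyMap, ← hPM, peval_reindexPolyMap, coe_blockDiagC, reindex_sumCongr_refl_fromBlocks_zero]
  · rintro ⟨A, B, hB, hN⟩
    obtain ⟨A₂, hA₂⟩ : ∃ A₂ : SpecialLinearGroup (Fin 2) ℂ,
        Matrix.reindex (finSumFinEquiv (m := 1) (n := 1)).symm (finSumFinEquiv (m := 1) (n := 1)).symm A₂.1 = A.1 :=
      ⟨⟨Matrix.reindex (finSumFinEquiv (m := 1) (n := 1)) (finSumFinEquiv (m := 1) (n := 1)) A.1, by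
          rw [Matrix.det_reindex_self, A.2]⟩, by
        dsimp only
        rw [← Matrix.reindex_symm, Equiv.symm_apply_apply]⟩
    have hP : blockDiagC (Fin 2) (Fin n ⊕ Fin n) (A₂, B) ∈
        hodgeGroupC (prodPeriod (ellipticPeriod (im_apply_pos Z₁).ne') (prinPeriod Z₂)) := by
      rw [hfullC]
      exact Subgroup.mem_map.2 ⟨(A₂, B), Subgroup.mem_prod.2 ⟨Subgroup.mem_top A₂, hB⟩, rfl⟩
    have hdet : (Matrix.reindex ((finSumFinEquiv (m := 1) (n := 1)).symm.sumCongr (Equiv.refl (Fin n ⊕ Fin n)))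
        ((finSumFinEquiv (m := 1) (n := 1)).symm.sumCongr (Equiv.refl (Fin n ⊕ Fin n)))
        (blockDiagC (Fin 2) (Fin n ⊕ Fin n) (A₂, B)).1).det = 1 := by
      rw [Matrix.det_reindex_self]
      exact (blockDiagC (Fin 2) (Fin n ⊕ Fin n) (A₂, B)).2
    refine ⟨⟨_, hdet⟩, stepθ.2 ⟨blockDiagC (Fin 2) (Fin n ⊕ Fin n) (A₂, B), hP, by rw [peval_reindexPolyMap]⟩, ?_⟩
    rw [peval_reindexPolyMap, hN]
    dsimp only
    rw [coe_blockDiagC]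
    dsimp only
    rw [reindex_sumCongr_refl_fromBlocks_zero, hA₂]

end ComplexPoints

end SiegelModuli

end Literature.AlgebraicGeometry.ModuliOfAbelianVarieties
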